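import Summits.KontsevichZagierPeriods.KontsevichZagierPeriods.Theorems.TerasomaMultiplicationBetaCancellationStubSlabDescent

/-!
# `BetaCancellation` (stmt-KontsevichZagierPeriods-13633), line `dirichlet-companion-to-pi` — stub `stub_wallLift`

**Wall lift.** Let `P n r : IntegralRep (n + 2)` be the pinned family "unit disc in the two leading
coordinates, `r` in the trailing `n`", and let `H : FormalRep →+ FormalRep` be an abstract *side
restriction*: on every representation `r` of dimension `k + 1` it returns `[s]` for the
representation `s` with `s.domain = r.domain ∩ {z | z 0 ∈ S}` and `s.integrand = r.integrand`, where
`S` is one of the two open sides `(-∞, -1/2)`, `(-1/2, ∞)` of the wall `x = -1/2`. Then `H` computes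
the slab pieces of `[π] * c`: for the matching rational slab `(a, b) = (-2, -1/2)` resp. `(-1/2, 2)`,
`[[π]|{a < x < b}] * c − H (lift (of ∘ P) c) ∈ KZ.relations`.

Proof. On the disc `z 0 ^ 2 + z 1 ^ 2 ≤ 1` one has `-1 ≤ z 0 ≤ 1`, so `z 0 < -1/2 ↔ -2 < z 0 < -1/2`
and `-1/2 < z 0 ↔ -1/2 < z 0 < 2` (`wallLift_slab_iff`); hence the side restriction of `P m t` is
its slab restriction, `H [P m t] = [(P m t)|slab]` (`wallLift_apply_of_pinned`), and on a generator
the claim is `of_piSlab_mul_of_sub_of_slabRestrict_mem_relations`. Both sides are additive in `c`: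
induction on the free abelian group (pattern of `piSlab_mul_sub_slabMap_lift_mem_relations`).
No definitions; sorry-free; axioms ⊆ {propext, Classical.choice, Quot.sound}.

References: M. Kontsevich, D. Zagier, *Periods* (2001), §1.2 rules (1)–(3); J. Ayoub, *Une version
relative de la conjecture des périodes de Kontsevich–Zagier*, Ann. of Math. 181 (2015), §1.
-/

noncomputable section

-- `Summit.KontsevichZagierPeriods.KontsevichZagierPeriods.…` is the tree's mandated layout (single-conjunct summit).
set_option linter.dupNamespace false

namespace Summit.KontsevichZagierPeriods.KontsevichZagierPeriods.BetaCancellationLine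

open Set
open Literature.NumberTheory.Transcendental
open Literature.NumberTheory.Transcendental.KZ

/-! ### On the disc, a side of the wall is a slab -/

/-- On the closed unit disc (`x ^ 2 + y ^ 2 ≤ 1`, so `-1 ≤ x ≤ 1`) the open side `S` of the wall
`x = -1/2` coincides with the matching bounded rational slab `(a, b)`: `a < x < b ↔ x ∈ S` for
`(S, a, b) = ((-∞,-1/2), -2, -1/2)` or `((-1/2,∞), -1/2, 2)`. [folklore] -/
theorem wallLift_slab_iff {S : Set ℝ} {a b : ℚ}
    (hS : (S = Set.Iio (-1/2 : ℝ) ∧ a = -2 ∧ b = -1/2) ∨ (S = Set.Ioi (-1/2 : ℝ) ∧ a = -1/2 ∧ b = 2))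
    {x y : ℝ} (h : x ^ 2 + y ^ 2 ≤ 1) : ((a : ℝ) < x ∧ x < b) ↔ x ∈ S := by
  have hx₁ : (-2 : ℝ) < x := by nlinarith [sq_nonneg y, sq_nonneg (x + 1)]
  have hx₂ : x < (2 : ℝ) := by nlinarith [sq_nonneg y, sq_nonneg (x - 1)]
  rcases hS with ⟨rfl, rfl, rfl⟩ | ⟨rfl, rfl, rfl⟩
  · rw [Set.mem_Iio]
    push_cast
    exact ⟨fun hab => hab.2, fun hx => ⟨hx₁, hx⟩⟩
  · rw [Set.mem_Ioi]
    push_cast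
    exact ⟨fun hab => hab.1, fun hx => ⟨hx, hx₂⟩⟩

/-- For the pinned disc family, the side restriction IS the slab restriction: the domain of
`(P m t)|{a < z 0 < b}` is `(P m t).domain ∩ {z | z 0 ∈ S}`. [folklore] -/
theorem wallLift_domain_slabRestrict_pinned
    (P : ∀ n : ℕ, IntegralRep n → IntegralRep (n + 2))
    (hP : ∀ (n : ℕ) (r : IntegralRep n),
      (P n r).domain = {z : Fin (n + 2) → ℝ | z 0 ^ 2 + z 1 ^ 2 ≤ 1 ∧ (fun i : Fin n => z i.succ.succ) ∈ r.domain} ∧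
      (P n r).integrand = fun z => r.integrand (fun i : Fin n => z i.succ.succ))
    {S : Set ℝ} {a b : ℚ}
    (hS : (S = Set.Iio (-1/2 : ℝ) ∧ a = -2 ∧ b = -1/2) ∨ (S = Set.Ioi (-1/2 : ℝ) ∧ a = -1/2 ∧ b = 2))
    (m : ℕ) (t : IntegralRep m) :
    ((P m t).slabRestrict a b).domain = (P m t).domain ∩ {z | z 0 ∈ S} := by
  rw [IntegralRep.domain_slabRestrict]
  ext z
  simp only [mem_inter_iff, mem_paramSlab, mem_setOf_eq, (hP m t).1]
  exact and_congr_right fun hz => wallLift_slab_iff hS hz.1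

/-- Hence an abstract side restriction `H` (pinned on generators of dimension `≥ 1` by
`H [r] = [r ∩ {z 0 ∈ S}]`) sends `[P m t]` to `[(P m t)|{a < z 0 < b}]`. [folklore] -/
theorem wallLift_apply_of_pinned
    (P : ∀ n : ℕ, IntegralRep n → IntegralRep (n + 2))
    (hP : ∀ (n : ℕ) (r : IntegralRep n),
      (P n r).domain = {z : Fin (n + 2) → ℝ | z 0 ^ 2 + z 1 ^ 2 ≤ 1 ∧ (fun i : Fin n => z i.succ.succ) ∈ r.domain} ∧
      (P n r).integrand = fun z => r.integrand (fun i : Fin n => z i.succ.succ))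
    {S : Set ℝ} {a b : ℚ}
    (hS : (S = Set.Iio (-1/2 : ℝ) ∧ a = -2 ∧ b = -1/2) ∨ (S = Set.Ioi (-1/2 : ℝ) ∧ a = -1/2 ∧ b = 2))
    {H : FormalRep →+ FormalRep}
    (hpin : ∀ (k : ℕ) (r s : IntegralRep (k + 1)), s.domain = r.domain ∩ {z | z 0 ∈ S} →
      s.integrand = r.integrand → H (of r) = of s)
    (m : ℕ) (t : IntegralRep m) :
    H (of (P m t)) = of ((P m t).slabRestrict a b) :=
  hpin (m + 1) (P m t) ((P m t).slabRestrict a b) (wallLift_domain_slabRestrict_pinned P hP hS m t) rfl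

/-! ### The stub -/

/-- STUB (wall lift): on the pinned disc family, a side restriction `H` computes the slab pieces of
`[π] * c`. [folklore] -/
theorem stub_wallLift :
    ∀ (P : ∀ n : ℕ, IntegralRep n → IntegralRep (n + 2)),
      (∀ (n : ℕ) (r : IntegralRep n), (P n r).domain = {z : Fin (n + 2) → ℝ | z 0 ^ 2 + z 1 ^ 2 ≤ 1 ∧ (fun i : Fin n => z i.succ.succ) ∈ r.domain} ∧ (P n r).integrand = fun z => r.integrand (fun i : Fin n => z i.succ.succ)) →
    ∀ (S : Set ℝ) (a b : ℚ),
      (S = Set.Iio (-1/2 : ℝ) ∧ a = -2 ∧ b = -1/2) ∨ (S = Set.Ioi (-1/2 : ℝ) ∧ a = -1/2 ∧ b = 2) →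
    ∀ (H : FormalRep →+ FormalRep),
      (∀ (k : ℕ) (r s : IntegralRep (k + 1)), s.domain = r.domain ∩ {z | z 0 ∈ S} →
          s.integrand = r.integrand → H (of r) = of s) →
      ∀ c : FormalRep,
        of (piRep.slabRestrict a b) * c -
          H (FreeAbelianGroup.lift (fun s : (Σ n, IntegralRep n) => of (P s.1 s.2)) c) ∈ relations := by
  intro P hP S a b hS H hpin c
  induction c using FreeAbelianGroup.induction_on with
  | zero => simp [relations.zero_mem]
  | of s =>
    obtain ⟨m, t⟩ := s
    rw [FreeAbelianGroup.lift_apply_of]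
    show of (piRep.slabRestrict a b) * of t - H (of (P m t)) ∈ relations
    rw [wallLift_apply_of_pinned P hP hS hpin m t]
    exact of_piSlab_mul_of_sub_of_slabRestrict_mem_relations P hP a b m t
  | neg s ih =>
    rw [mul_neg, map_neg, map_neg, ← neg_sub']
    exact relations.neg_mem ih
  | add x y hx hy =>
    rw [mul_add, map_add, map_add, ← sub_add_sub_comm]
    exact relations.add_mem hx hy

end Summit.KontsevichZagierPeriods.KontsevichZagierPeriods.BetaCancellationLine
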